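import Summits.HodgeConjecture.HodgeConjecture.Theses.EndoscopicMiddleDegree
import Literature.AlgebraicGeometry.HodgeTheory.LefschetzOneOne
import Literature.AlgebraicGeometry.HodgeTheory.HodgeModelExistence
import Literature.AlgebraicGeometry.HodgeTheory.RealStructureSingular
import Literature.AlgebraicGeometry.HodgeTheory.ComplexConjugation
import Literature.AlgebraicGeometry.HodgeTheory.AbsoluteHodgeClasses

/-!
# `BallQuotientHodgeAbsolute` (stmt-HodgeConjecture-14348) · Negative · Hodge ⇒ absolute Hodge on ball quotients

Negative-side knowledge for the crux `EndoscopicMiddleDegree.BallQuotientHodgeAbsolute` — DROPPED from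
the route at rev 4 (2026-08-16), item closed as moot; since the 2026-08-17 dependency-drift repair the
token `BallQuotientHodgeAbsolute` below is a file-local notation for its statement, see the comment after
the `open` lines —
(every rational middle-degree Hodge class on an even-dimensional compact arithmetic ball quotient
`X(ℂ) ≅ Γ\𝔹^{2(m+1)}` carrying a `UnitaryBallQuotientDatum` is absolute Hodge — the instance of
Charles–Schnell's Conjecture 11.2.17 "Hodge classes are absolute Hodge" for this family and degree),
all sorry-free, extracted from the standing disprover's work file
`Cruxes/BallQuotientHodgeAbsolute/Disproof.lean` (refuter-cdisprove-stmt-HodgeConjecture-14348-0,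
cycle 1, 2026-08-16) so that ideators, planners and provers can import them. Printed inputs that the
tree does not have enter as EXPLICIT hypotheses, chiefly "cycle classes are absolute Hodge"
(Charles–Schnell §11.2.2, after Def. 11.2.3: "the cohomology class of an algebraic cycle is an
absolute Hodge class"; Deligne 1982, Ex. 2.1(a)), spelled
`∀ n X, IsSmoothProjective n X → ∀ p c, IsRationalClass c → IsOfHodgeType n X (2p) p p c →
c ∈ algebraicClasses X p → IsAbsoluteHodgeClass n X p c`.

* `ballQuotientHodgeAbsolute_iff_conjugationClause`: READ-BACK — the conclusion restates the two
  hypotheses, so the crux is the bare conjugation clause; `m` is unrestricted (the route's sector is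
  `m ∈ {1,2}`).
* `not_hodgeConjecture_of_not_ballQuotientHodgeAbsolute`: a kill of the crux is a DISPROOF OF THE
  HODGE CONJECTURE (granting cycle classes absolute Hodge) — kill criterion (iii) of the route, formal;
  more generally `not_hodgeConjecture_of_exists_not_isAbsoluteHodgeClass`: one non-absolute rational
  Hodge class in ANY degree on ANY compact ball quotient of the family refutes HC, so no strengthening of
  the crux inside "Hodge ⇒ absolute Hodge on ball quotients" is refutable short of `¬HC`.
* `ballQuotientHodgeAbsolute_iff_middleHodge`: granting cycle-classes-AH and "absolute Hodge ⇒
  algebraic" on the family, the crux is EQUIVALENT to middle-degree HC on the family — it is the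
  arithmetic half of the target, not a side bet.
* `not_middleDegreeStep_of_not_level_one`, `not_middleDegreeStep_of_not_level`: inside the route the
  crux at the sector levels is NECESSARY for the target `MiddleDegreeStep` (at `m = 1` modulo only
  Lefschetz `(1,1)` and cycle-classes-AH).
* `level_zero_of_lefschetz`: the degenerate level `m = 0` (degree 2 on compact 2-ball quotient surfaces)
  is Lefschetz `(1,1)` + cycle classes AH — classical, no counterexamples there.
* `eq_zero_of_isRationalClass_of_I_smul`, `eq_zero_of_forall_isOfHodgeType_isAbsoluteHodgeClass`,
  `not_withoutRational_of_exists`, `not_withoutHodgeType_of_exists`,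
  `absoluteHodge_of_hodgeConjecture_smoothProjective`: LOAD-BEARING ANALYSIS — dropping rationality or
  the Hodge-type hypothesis yields absurdities (every `(p,p)`-class would vanish, resp. every rational
  class would be `(p,p)`), while dropping the whole DATUM yields a statement still implied by HC: no
  field of `UnitaryBallQuotientDatum` is load-bearing for the truth of the crux, only for its intended
  automorphic proof.
* `nonempty_conjugationChart_of_isAbsoluteHodgeClass`, `nonempty_conjugationChart_of_ballQuotientHodgeAbsolute`,
  `isAbsoluteHodgeClass_zero_iff`: WHAT ANY PROOF MUST BUILD — a `ConjugationChart σ X (2(m+1))` for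
  every `σ ∈ Aut ℂ` (Jouanolou cover + analytifications + natural rational de Rham family; none
  constructible today), and even for `c = 0` the uniqueness half is Grothendieck's comparison theorem.
-/

noncomputable section

open CategoryTheory

namespace Summit.HodgeConjecture.HodgeConjecture.Theorems.BallQuotientHodgeAbsolute.Negative

open Summit.HodgeConjecture.HodgeConjecture.Theses.EndoscopicMiddleDegree
open Literature.AlgebraicGeometry Literature.AlgebraicGeometry.HodgeTheory
  Literature.AlgebraicGeometry.Motives Literature.AlgebraicGeometry.ShimuraVarieties
  Literature.AlgebraicTopology.SingularHomology

/- **The dropped crux, verbatim, as a local notation.** The route decl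
`Theses.EndoscopicMiddleDegree.BallQuotientHodgeAbsolute` (stmt-HodgeConjecture-14348) was DROPPED from the
route at rev 4 (2026-08-16T03:06Z, "not load-bearing"; item closed as moot) and no constant of that name
exists any more; the route file also stopped importing `AbsoluteHodgeClasses` (cone repairs), which this
module now imports itself. To keep every theorem below letter for letter (Theorems files are append-only)
without declaring a proposition in a Theorems file, the token is a file-LOCAL NOTATION expanding to the
statement of the dropped item, verbatim from its ledger signature: for every level `m`, every
`X / ℂ` carrying a `UnitaryBallQuotientDatum (2(m+1)) X`, and every rational class `c` of Hodge type
`(m+1, m+1)` in degree `2(m+1)`, `c` is an absolute Hodge class. The notation is invisible outside this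
file; the elaborated types of the theorems carry the statement itself (`quotPrecheck` is off for this one
command only: the binder notation `∀` has no precheck handler; every name in the body is fully
qualified). Dependency-drift repair 2026-08-17; no statement or proof below was changed. -/
set_option quotPrecheck false in
local notation "BallQuotientHodgeAbsolute" =>
  (∀ (m : ℕ) (X : Literature.AlgebraicGeometry.Motives.SchemeOver ℂ), Nonempty (Literature.AlgebraicGeometry.ShimuraVarieties.UnitaryBallQuotientDatum (2 * (m + 1)) X) → ∀ c : Literature.AlgebraicGeometry.HodgeTheory.complexBetti X (2 * (m + 1)), Literature.AlgebraicGeometry.HodgeTheory.IsRationalClass c → Literature.AlgebraicGeometry.HodgeTheory.IsOfHodgeType (2 * (m + 1)) X (2 * (m + 1)) (m + 1) (m + 1) c → Literature.AlgebraicGeometry.HodgeTheory.IsAbsoluteHodgeClass (2 * (m + 1)) X (m + 1) c)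

/-! ## Read-back: the crux is the bare conjugation clause -/

/-- **Read-back.** `IsAbsoluteHodgeClass n X p c` is `IsRationalClass c ∧ IsOfHodgeType n X (2p) p p c ∧
(conjugation clause)`, and the first two conjuncts are the hypotheses of the crux; so the crux says
exactly: for every `σ ∈ Aut ℂ`, a `σ`-conjugate of the rational middle `(p,p)`-class `c` exists and
every `σ`-conjugate is `(2πi/σ(2πi))ᵖ` times a rational `(p,p)`-class on `X^σ`. The level `m` is
unrestricted. [cite: CharlesSchnell2014Notes, Def. 11.2.3] -/
theorem ballQuotientHodgeAbsolute_iff_conjugationClause :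
    BallQuotientHodgeAbsolute ↔
      ∀ (m : ℕ) (X : SchemeOver ℂ), Nonempty (UnitaryBallQuotientDatum (2 * (m + 1)) X) →
        ∀ c : complexBetti X (2 * (m + 1)), IsRationalClass c →
          IsOfHodgeType (2 * (m + 1)) X (2 * (m + 1)) (m + 1) (m + 1) c →
            ∀ σ : ℂ ≃+* ℂ,
              (∃ c', IsConjugateClass σ X (2 * (m + 1)) c c') ∧
                ∀ c', IsConjugateClass σ X (2 * (m + 1)) c c' →
                  ∃ β : complexBetti (conjugateVariety σ X) (2 * (m + 1)),
                    IsRationalClass β ∧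
                      IsOfHodgeType (2 * (m + 1)) (conjugateVariety σ X) (2 * (m + 1)) (m + 1) (m + 1) β ∧
                        c' = periodTwist σ (m + 1) • β :=
  ⟨fun h m X hD c hc hH ↦ (h m X hD c hc hH).2.2,
    fun h m X hD c hc hH ↦ ⟨hc, hH, h m X hD c hc hH⟩⟩

/-! ## A kill of the crux is a disproof of the Hodge conjecture -/

/-- **No strengthening is refutable short of `¬HC`.** Granting that cycle classes are absolute Hodge
(Charles–Schnell §11.2.2; Deligne 1982 Ex. 2.1(a)), ONE rational Hodge class that is not absolute
Hodge, in ANY degree `2p` on ANY compact ball quotient of the family (any dimension `d`), refutes the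
Hodge conjecture: the datum records that `X` is smooth projective of dimension `d`, HC makes the class
algebraic, and algebraic classes are absolute Hodge. [cite: CharlesSchnell2014Notes, §11.2.5 Conj. 11.2.17] -/
theorem not_hodgeConjecture_of_exists_not_isAbsoluteHodgeClass
    (hAH : ∀ ⦃n : ℕ⦄ ⦃X : SchemeOver ℂ⦄, IsSmoothProjective n X →
      ∀ (p : ℕ) (c : complexBetti X (2 * p)), IsRationalClass c → IsOfHodgeType n X (2 * p) p p c →
        c ∈ algebraicClasses X p → IsAbsoluteHodgeClass n X p c)
    (hex : ∃ (d : ℕ) (X : SchemeOver ℂ) (_ : UnitaryBallQuotientDatum d X) (p : ℕ)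
      (c : complexBetti X (2 * p)),
        IsRationalClass c ∧ IsOfHodgeType d X (2 * p) p p c ∧ ¬ IsAbsoluteHodgeClass d X p c) :
    ¬ _root_.HodgeConjecture := by
  rintro hHC
  obtain ⟨d, X, D, p, c, hc, hH, hnot⟩ := hex
  exact hnot (hAH D.isSmoothProjective p c hc hH ((hHC D.isSmoothProjective).2 p c hc hH))

/-- **Kill criterion (iii) of the route, formal.** Granting that cycle classes are absolute Hodge, a
refutation of `BallQuotientHodgeAbsolute` is a refutation of the Hodge conjecture. Hence the crux is
refutable only by a counterexample to HC (a Hodge class that is not absolute Hodge), of which none is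
known on any variety. [cite: CharlesSchnell2014Notes, §11.2.5 Conj. 11.2.17] -/
theorem not_hodgeConjecture_of_not_ballQuotientHodgeAbsolute
    (hAH : ∀ ⦃n : ℕ⦄ ⦃X : SchemeOver ℂ⦄, IsSmoothProjective n X →
      ∀ (p : ℕ) (c : complexBetti X (2 * p)), IsRationalClass c → IsOfHodgeType n X (2 * p) p p c →
        c ∈ algebraicClasses X p → IsAbsoluteHodgeClass n X p c)
    (h : ¬ BallQuotientHodgeAbsolute) : ¬ _root_.HodgeConjecture := by
  refine not_hodgeConjecture_of_exists_not_isAbsoluteHodgeClass hAH ?_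
  by_contra hex
  refine h fun m X hD c hc hH ↦ ?_
  by_contra hnot
  exact hex ⟨2 * (m + 1), X, hD.some, m + 1, c, hc, hH, hnot⟩

/-- **The crux is the arithmetic half of middle-degree HC on the family.** Granting cycle classes
absolute Hodge (`hAH`) and "absolute Hodge ⇒ algebraic" for middle classes on the family (`hA`,
Charles–Schnell Conj. 11.2.18 there), the crux is EQUIVALENT to the middle-degree Hodge conjecture for
even-dimensional compact ball quotients (all levels `m`; the route target's conclusion without its
sector bound). [cite: CharlesSchnell2014Notes, §11.2.5 Conj. 11.2.17 and Conj. 11.2.18] -/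
theorem ballQuotientHodgeAbsolute_iff_middleHodge
    (hAH : ∀ ⦃n : ℕ⦄ ⦃X : SchemeOver ℂ⦄, IsSmoothProjective n X →
      ∀ (p : ℕ) (c : complexBetti X (2 * p)), IsRationalClass c → IsOfHodgeType n X (2 * p) p p c →
        c ∈ algebraicClasses X p → IsAbsoluteHodgeClass n X p c)
    (hA : ∀ (m : ℕ) (X : SchemeOver ℂ), Nonempty (UnitaryBallQuotientDatum (2 * (m + 1)) X) →
      ∀ c : complexBetti X (2 * (m + 1)), IsAbsoluteHodgeClass (2 * (m + 1)) X (m + 1) c →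
        c ∈ algebraicClasses X (m + 1)) :
    BallQuotientHodgeAbsolute ↔
      ∀ (m : ℕ) (X : SchemeOver ℂ), Nonempty (UnitaryBallQuotientDatum (2 * (m + 1)) X) →
        ∀ c : complexBetti X (2 * (m + 1)), IsRationalClass c →
          IsOfHodgeType (2 * (m + 1)) X (2 * (m + 1)) (m + 1) (m + 1) c →
            c ∈ algebraicClasses X (m + 1) :=
  ⟨fun h m X hD c hc hH ↦ hA m X hD c (h m X hD c hc hH),
    fun h m X hD c hc hH ↦ hAH hD.some.isSmoothProjective (m + 1) c hc hH (h m X hD c hc hH)⟩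

/-! ## Inside the route: the crux at the sector levels is NECESSARY for the target -/

/-- **At level `m = 1` the target needs the crux** (modulo Lefschetz `(1,1)` and cycle classes absolute
Hodge): if some rational `(2,2)`-class on some compact arithmetic 4-ball quotient is not absolute
Hodge, the route target `MiddleDegreeStep` is false — its `m = 1` instance makes that class algebraic
(its lower-degree hypothesis being Lefschetz `(1,1)`, tree fact `lefschetzOneOne_rational`).
[cite: VoisinHodgeI2002, Thm. 11.30] -/
theorem not_middleDegreeStep_of_not_level_one
    (hAH : ∀ ⦃n : ℕ⦄ ⦃X : SchemeOver ℂ⦄, IsSmoothProjective n X →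
      ∀ (p : ℕ) (c : complexBetti X (2 * p)), IsRationalClass c → IsOfHodgeType n X (2 * p) p p c →
        c ∈ algebraicClasses X p → IsAbsoluteHodgeClass n X p c)
    (hL : lefschetzOneOne_rational)
    (h : ¬ ∀ (X : SchemeOver ℂ), Nonempty (UnitaryBallQuotientDatum (2 * (1 + 1)) X) →
      ∀ c : complexBetti X (2 * (1 + 1)), IsRationalClass c →
        IsOfHodgeType (2 * (1 + 1)) X (2 * (1 + 1)) (1 + 1) (1 + 1) c →
          IsAbsoluteHodgeClass (2 * (1 + 1)) X (1 + 1) c) :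
    ¬ MiddleDegreeStep := by
  rintro hS
  refine h fun X hD c hc hH ↦ hAH hD.some.isSmoothProjective (1 + 1) c hc hH ?_
  exact hS 1 X le_rfl one_le_two hD (fun a ha h11 ↦ hL hD.some.isSmoothProjective a ha h11) c hc hH

/-- **At a sector level `m ∈ {1,2}` the target needs the crux** (modulo that level's lower-degree input
and cycle classes absolute Hodge): a non-absolute rational middle `(p,p)`-class at level `m` refutes
`MiddleDegreeStep`, given HC in degree `2m` on the family (Lefschetz at `m = 1`, BMM Cor. 2 at `m = 2`).
[cite: BergeronMillsonMoeglin2016Balls, Cor. 2] -/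
theorem not_middleDegreeStep_of_not_level
    (hAH : ∀ ⦃n : ℕ⦄ ⦃X : SchemeOver ℂ⦄, IsSmoothProjective n X →
      ∀ (p : ℕ) (c : complexBetti X (2 * p)), IsRationalClass c → IsOfHodgeType n X (2 * p) p p c →
        c ∈ algebraicClasses X p → IsAbsoluteHodgeClass n X p c)
    {m : ℕ} (h1 : 1 ≤ m) (h2 : m ≤ 2)
    (hlow : ∀ X : SchemeOver ℂ, Nonempty (UnitaryBallQuotientDatum (2 * (m + 1)) X) →
      ∀ a : complexBetti X (2 * m), IsRationalClass a →
        IsOfHodgeType (2 * (m + 1)) X (2 * m) m m a → a ∈ algebraicClasses X m)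
    (h : ¬ ∀ (X : SchemeOver ℂ), Nonempty (UnitaryBallQuotientDatum (2 * (m + 1)) X) →
      ∀ c : complexBetti X (2 * (m + 1)), IsRationalClass c →
        IsOfHodgeType (2 * (m + 1)) X (2 * (m + 1)) (m + 1) (m + 1) c →
          IsAbsoluteHodgeClass (2 * (m + 1)) X (m + 1) c) :
    ¬ MiddleDegreeStep := fun hS ↦
  h fun X hD c hc hH ↦
    hAH hD.some.isSmoothProjective (m + 1) c hc hH (hS m X h1 h2 hD (hlow X hD) c hc hH)

/-! ## The degenerate level `m = 0` is classical -/

/-- **Level `0` (degree 2 on a compact 2-ball quotient surface) holds in print**: a rational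
`(1,1)`-class is a divisor class (Lefschetz, tree fact `lefschetzOneOne_rational`), and cycle classes are
absolute Hodge. Not a source of counterexamples; the first open level is `m = 1` (rational
`(2,2)`-classes on compact arithmetic 4-ball quotients). [cite: VoisinHodgeI2002, Thm. 11.30] -/
theorem level_zero_of_lefschetz
    (hAH : ∀ ⦃n : ℕ⦄ ⦃X : SchemeOver ℂ⦄, IsSmoothProjective n X →
      ∀ (p : ℕ) (c : complexBetti X (2 * p)), IsRationalClass c → IsOfHodgeType n X (2 * p) p p c →
        c ∈ algebraicClasses X p → IsAbsoluteHodgeClass n X p c)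
    (hL : lefschetzOneOne_rational) (X : SchemeOver ℂ)
    (hD : Nonempty (UnitaryBallQuotientDatum (2 * (0 + 1)) X)) (c : complexBetti X (2 * (0 + 1)))
    (hc : IsRationalClass c) (hH : IsOfHodgeType (2 * (0 + 1)) X (2 * (0 + 1)) (0 + 1) (0 + 1) c) :
    IsAbsoluteHodgeClass (2 * (0 + 1)) X (0 + 1) c :=
  hAH hD.some.isSmoothProjective (0 + 1) c hc hH (hL hD.some.isSmoothProjective c hc hH)

/-! ## Load-bearing hypotheses -/

/-- **A class `c` with `c` and `i • c` both rational is zero**: rational classes are real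
(`conj c = c`), so `im c = 0` and `im (i • c) = re c = 0`, whence `c = re c ⊗ 1 + i • (im c ⊗ 1) = 0`.
[cite: VoisinHodgeI2002, §6.1.3 Cor. 6.12] -/
theorem eq_zero_of_isRationalClass_of_I_smul {Y : Type} [TopologicalSpace Y] {k : ℕ}
    {c : singularCohomology ℂ ℂ Y k} (hc : IsRationalClass c)
    (hI : IsRationalClass (Complex.I • c)) : c = 0 := by
  have him : imClass Y k c = 0 := (conjClass_eq_self_iff_imClass_eq_zero c).1 hc.conjClass_eq
  have hre : reClass Y k c = 0 := by
    rw [← imClass_I_smul]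
    exact (conjClass_eq_self_iff_imClass_eq_zero _).1 hI.conjClass_eq
  rw [← ofRealClass_reClass_add_I_smul c, hre, him, map_zero, smul_zero, add_zero]

/-- Hodge type is stable under complex scalars (`H^{p,q}` of a Hodge model is a complex subspace).
[cite: VoisinHodgeI2002, §7.1.1] -/
theorem isOfHodgeType_smul {n : ℕ} {X : SchemeOver ℂ} {k p q : ℕ} {c : complexBetti X k}
    (h : IsOfHodgeType n X k p q c) (a : ℂ) : IsOfHodgeType n X k p q (a • c) := by
  obtain ⟨A, hA⟩ := h
  exact ⟨A, by rw [map_smul]; exact Submodule.smul_mem _ a hA⟩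

/-- **Rationality is load-bearing — dropping it is absurd.** If on some `X` every `(p,p)`-class in
degree `2p` were absolute Hodge (rationality hypothesis dropped), then every `(p,p)`-class would be
rational, hence (`c` and `i • c` both rational) ZERO: `H^{p,p} = 0`. [folklore] -/
theorem eq_zero_of_forall_isOfHodgeType_isAbsoluteHodgeClass {n : ℕ} {X : SchemeOver ℂ} {p : ℕ}
    (h : ∀ c : complexBetti X (2 * p), IsOfHodgeType n X (2 * p) p p c → IsAbsoluteHodgeClass n X p c)
    {c : complexBetti X (2 * p)} (hc : IsOfHodgeType n X (2 * p) p p c) : c = 0 :=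
  eq_zero_of_isRationalClass_of_I_smul (h c hc).1 (h _ (isOfHodgeType_smul hc Complex.I)).1

/-- **`WithoutRational` is false modulo existence**: one even-dimensional compact ball quotient of the
family with one non-zero middle `(p,p)`-class (in print every one: `ω^{m+1} ≠ 0` by hard Lefschetz)
refutes the crux-without-rationality. The tree constructs no datum, whence the existence hypothesis.
[cite: VoisinHodgeI2002, Thm. 6.25] -/
theorem not_withoutRational_of_exists
    (hex : ∃ (m : ℕ) (X : SchemeOver ℂ), Nonempty (UnitaryBallQuotientDatum (2 * (m + 1)) X) ∧
      ∃ c : complexBetti X (2 * (m + 1)),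
        IsOfHodgeType (2 * (m + 1)) X (2 * (m + 1)) (m + 1) (m + 1) c ∧ c ≠ 0) :
    ¬ ∀ (m : ℕ) (X : SchemeOver ℂ), Nonempty (UnitaryBallQuotientDatum (2 * (m + 1)) X) →
      ∀ c : complexBetti X (2 * (m + 1)),
        IsOfHodgeType (2 * (m + 1)) X (2 * (m + 1)) (m + 1) (m + 1) c →
          IsAbsoluteHodgeClass (2 * (m + 1)) X (m + 1) c := by
  rintro h
  obtain ⟨m, X, hD, c, hH, hc⟩ := hex
  exact hc (eq_zero_of_forall_isOfHodgeType_isAbsoluteHodgeClass (h m X hD) hH)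

/-- **`WithoutHodgeType` is false modulo existence**: dropping the Hodge-type hypothesis makes every
rational middle class of type `(p,p)`; one datum with a rational middle class NOT of type `(p,p)` (in
print: any compact 2-ball quotient with `p_g > 0` — then `b₂ = 2p_g + h^{1,1} > h^{1,1} ≥ ρ` — e.g. deep
congruence covers, by `c₁² = 3c₂ = 9χ(𝒪)`) refutes it. [cite: BergeronMillsonMoeglin2016Balls, Cor. 62] -/
theorem not_withoutHodgeType_of_exists
    (hex : ∃ (m : ℕ) (X : SchemeOver ℂ), Nonempty (UnitaryBallQuotientDatum (2 * (m + 1)) X) ∧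
      ∃ c : complexBetti X (2 * (m + 1)), IsRationalClass c ∧
        ¬ IsOfHodgeType (2 * (m + 1)) X (2 * (m + 1)) (m + 1) (m + 1) c) :
    ¬ ∀ (m : ℕ) (X : SchemeOver ℂ), Nonempty (UnitaryBallQuotientDatum (2 * (m + 1)) X) →
      ∀ c : complexBetti X (2 * (m + 1)), IsRationalClass c →
        IsAbsoluteHodgeClass (2 * (m + 1)) X (m + 1) c := by
  rintro h
  obtain ⟨m, X, hD, c, hc, hH⟩ := hex
  exact hH (h m X hD c hc).2.1

/-- **The datum is not load-bearing for truth.** With the whole `UnitaryBallQuotientDatum` replaced by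
mere smooth projectivity, the statement ("Hodge ⇒ absolute Hodge", Charles–Schnell Conj. 11.2.17, for
all smooth projective varieties and all degrees) is still a consequence of HC + cycle classes absolute
Hodge — and it trivially specialises to the crux. So no field of the datum (CM field, anisotropy,
congruence condition, torsion-freeness, uniformisation, special cycles) can be exploited by a refuter
without refuting HC; the datum matters only for the intended automorphic PROOF.
[cite: CharlesSchnell2014Notes, §11.2.5 Conj. 11.2.17] -/
theorem absoluteHodge_of_hodgeConjecture_smoothProjective
    (hAH : ∀ ⦃n : ℕ⦄ ⦃X : SchemeOver ℂ⦄, IsSmoothProjective n X →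
      ∀ (p : ℕ) (c : complexBetti X (2 * p)), IsRationalClass c → IsOfHodgeType n X (2 * p) p p c →
        c ∈ algebraicClasses X p → IsAbsoluteHodgeClass n X p c)
    (hHC : _root_.HodgeConjecture) {n : ℕ} {X : SchemeOver ℂ} (hX : IsSmoothProjective n X) (p : ℕ)
    (c : complexBetti X (2 * p)) (hc : IsRationalClass c) (hH : IsOfHodgeType n X (2 * p) p p c) :
    IsAbsoluteHodgeClass n X p c :=
  hAH hX p c hc hH ((hHC hX).2 p c hc hH)

/-! ## What any proof must construct -/

/-- An absolute Hodge class comes with a conjugation chart for every automorphism of `ℂ` (the existence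
conjunct of the definition). [cite: CharlesSchnell2014Notes, §11.2.2] -/
theorem nonempty_conjugationChart_of_isAbsoluteHodgeClass {n : ℕ} {X : SchemeOver ℂ} {p : ℕ}
    {c : complexBetti X (2 * p)} (h : IsAbsoluteHodgeClass n X p c) (σ : ℂ ≃+* ℂ) :
    Nonempty (ConjugationChart σ X (2 * p)) := by
  obtain ⟨_, D, _⟩ := (h.2.2 σ).1
  exact ⟨D⟩

/-- **Lower bound on any proof of the crux.** It yields, for every even-dimensional compact ball
quotient of the family (granted its Hodge model, tree fact `nonempty_hodgeModel`) and EVERY `σ ∈ Aut ℂ`,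
a conjugation chart in the middle degree (apply the crux to `c = 0`): a smooth affine `Y → X` with
`(π^σ)^*` injective on `H^{2(m+1)}`, analytifications of `Y` and `Y^σ` on one model space, and a natural
rationally normalised de Rham family — Jouanolou's device + GAGA + de Rham's theorem, none in the tree.
[cite: Jouanolou1973, Lemme 1.5] -/
theorem nonempty_conjugationChart_of_ballQuotientHodgeAbsolute (h : BallQuotientHodgeAbsolute) {m : ℕ}
    {X : SchemeOver ℂ} (hD : Nonempty (UnitaryBallQuotientDatum (2 * (m + 1)) X))
    (hM : nonempty_hodgeModel (2 * (m + 1)) X) (σ : ℂ ≃+* ℂ) :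
    Nonempty (ConjugationChart σ X (2 * (m + 1))) :=
  nonempty_conjugationChart_of_isAbsoluteHodgeClass
    (h m X hD 0 IsRationalClass.zero
      (isOfHodgeType_zero_of_isSmoothProjective hM hD.some.isSmoothProjective _ _ _)) σ

/-- **Even `c = 0` is not gratis.** Once `0` is of type `(p,p)` (a Hodge model exists), `0` is absolute
Hodge iff for every `σ` a conjugation chart EXISTS and every conjugate of `0` is a twisted rational
`(p,p)`-class — the latter is "every conjugate of `0` is `0`", Grothendieck's algebraic/analytic de Rham
comparison on the affine chart, absent from the tree. [cite: Grothendieck1966, Thm. 1'] -/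
theorem isAbsoluteHodgeClass_zero_iff {n : ℕ} {X : SchemeOver ℂ} {p : ℕ}
    (h0 : IsOfHodgeType n X (2 * p) p p 0) :
    IsAbsoluteHodgeClass n X p 0 ↔
      ∀ σ : ℂ ≃+* ℂ, Nonempty (ConjugationChart σ X (2 * p)) ∧
        ∀ c', IsConjugateClass σ X (2 * p) 0 c' →
          ∃ β : complexBetti (conjugateVariety σ X) (2 * p),
            IsRationalClass β ∧ IsOfHodgeType n (conjugateVariety σ X) (2 * p) p p β ∧
              c' = periodTwist σ p • β := by
  constructor
  · intro h σ
    exact ⟨nonempty_conjugationChart_of_isAbsoluteHodgeClass h σ, (h.2.2 σ).2⟩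
  · intro h
    refine ⟨IsRationalClass.zero, h0, fun σ ↦ ⟨?_, (h σ).2⟩⟩
    obtain ⟨D⟩ := (h σ).1
    exact ⟨0, isConjugateClass_zero D⟩

/-- The natural WEAKENING of the conclusion — Voisin's weakly absolute Hodge classes (Def. 2.1: each
conjugate a `ℚ̄`-multiple of a twisted rational class) — follows from the crux (`t = 1`); a refuter
gains nothing by attacking the weak form instead. [cite: Voisin2007HodgeLoci, Def. 2.1] -/
theorem isWeaklyAbsoluteHodgeClass_of_ballQuotientHodgeAbsolute (h : BallQuotientHodgeAbsolute) (m : ℕ)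
    (X : SchemeOver ℂ) (hD : Nonempty (UnitaryBallQuotientDatum (2 * (m + 1)) X))
    (c : complexBetti X (2 * (m + 1))) (hc : IsRationalClass c)
    (hH : IsOfHodgeType (2 * (m + 1)) X (2 * (m + 1)) (m + 1) (m + 1) c) :
    IsWeaklyAbsoluteHodgeClass (2 * (m + 1)) X (m + 1) c :=
  (h m X hD c hc hH).isWeaklyAbsoluteHodgeClass

end Summit.HodgeConjecture.HodgeConjecture.Theorems.BallQuotientHodgeAbsolute.Negative

end
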